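import Mathlib
import Summits.Ventures.HodgeRepro.Tier4.Line1.RTFSetting
import Summits.Ventures.HodgeRepro.Tier4.Line1.HeckeFinitenessType
import Summits.Ventures.HodgeRepro.Tier4.Line1.LevelBlockFinite
import Summits.Ventures.HodgeRepro.Tier4.Line1.GeneratedSubspace
import Summits.Ventures.HodgeRepro.Tier4.Line1.IsotypicIdempotent

/-!
# Tier4/Line1/IsotypicBlock — the FIXED SPACE of `R(eσ)` has LEFT TYPE σ, so the type-σ block is FINITE-DIMENSIONAL
(module 3 of plan-1's cut (S3σ) S14082; the displayed `[FiniteDimensional ℂ Vb]` of p5's `IdempotentData` S14087 / p689660)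

Blind re-derivation cell `pub-hodge-repro`, Tier 4 (README §9–§10), seat t4-L1-p3 (prover, LINE L1, gen 3).  Target tree
path `lean/Summits/Ventures/HodgeRepro/Tier4/Line1/IsotypicBlock.lean`.  Imports this seat's `IsotypicIdempotent`
(p690327: `repExt`, `charExt`, `eσ`, `IsUnitaryRep`, `eσ_of_not_mem`, `continuous_eσ`), t4-L1-p1's `HeckeFinitenessType`
(`HasLeftType`) and `LevelBlockFinite` (`levelBlock`, `finiteDimensional_levelBlock`), t4-L1-p2's `GeneratedSubspace`
(`R_add'`, `R_smul'`, `R_zero'`).  0 printed inputs.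

CONTENT.  `coeff ρ : Fin (d * d) → K → ℂ` = the matrix coefficients `k ↦ ρ(k)_{ij}` of `ρ` as p1's LEFT TYPE;
`conj_charExt_inv_mul`: `conj χ_σ(k⁻¹ h) = ∑_{i,j} ρ(k)_{ji} conj ρ̃(h)_{ji}` for `k ∈ K`;
**`hasLeftType_R_eσ`**: for every continuous `ψ`, `R(eσ) ψ` has left type `coeff ρ` (the substitution `h ↦ k⁻¹ h` and the
identity above: `R(eσ)ψ(x k) = ∑_{i,j} ρ(k)_{ji} · (d μ(K)⁻¹ ∫ conj ρ̃(h)_{ji} ψ(x h) dμ)`);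
`isotypicFixed S K ρ` = the fixed space `{ψ | invariant ∧ continuous ∧ R(eσ) ψ = ψ}` as a ℂ-subspace (p5's `hVb` is
`mem_isotypicFixed`, definitional); `isotypicFixed_le_levelBlock` and **`finiteDimensional_isotypicFixed (hKo)`** — the
block of type σ is finite-dimensional by p1's (A).  What is NOT here: `R(eσ) ψ = ψ` on every function of left type σ
(module 4, from `schur_orthogonality`), the `H`-module structure, (C1), (C2), the instance's corner forms, `P_T4`.
Nothing here says anything about the status of the Hodge conjecture for CM abelian varieties, which is NOT proved
(HC_CM is NOT proved by anyone in this repository).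
-/

set_option autoImplicit false

noncomputable section

namespace Summit.Ventures.HodgeRepro.Tier4.Line1

open MeasureTheory Topology Set Matrix

namespace RTF.Setting

variable {G : Type} [Group G] [TopologicalSpace G] [IsTopologicalGroup G] [MeasurableSpace G] [BorelSpace G]
  (S : Setting G) (K : Subgroup G) {d : ℕ} (ρ : K →* Matrix (Fin d) (Fin d) ℂ)

section Coeff

variable {K} in
omit [TopologicalSpace G] [IsTopologicalGroup G] [MeasurableSpace G] [BorelSpace G] in
/-- the matrix coefficients `k ↦ ρ(k)_{ij}` of `ρ`, indexed by `Fin (d * d)` (p1's left-type vocabulary). -/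
def coeff : Fin (d * d) → K → ℂ := fun p k => ρ k (finProdFinEquiv.symm p).1 (finProdFinEquiv.symm p).2

omit [TopologicalSpace G] [IsTopologicalGroup G] [MeasurableSpace G] [BorelSpace G] in
/-- `coeff` at the index of `(i, j)` is the `(i, j)` matrix coefficient. -/
theorem coeff_apply (i j : Fin d) (k : K) : coeff ρ (finProdFinEquiv (i, j)) k = ρ k i j := by
  simp [coeff]

omit [TopologicalSpace G] [IsTopologicalGroup G] [MeasurableSpace G] [BorelSpace G] in
/-- for `k ∈ K` and every `h ∈ G`: `conj χ_σ(k⁻¹ h) = ∑_{i,j} ρ(k)_{ji} · conj ρ̃(h)_{ji}` (unitarity of `ρ`). -/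
theorem conj_charExt_inv_mul (hu : IsUnitaryRep ρ) (k : K) (h : G) :
    starRingEnd ℂ (charExt K ρ ((k : G)⁻¹ * h)) = ∑ i, ∑ j, ρ k j i * starRingEnd ℂ (repExt K ρ h j i) := by
  by_cases hh : h ∈ K
  · unfold charExt
    rw [repExt_mul K ρ (K.inv_mem k.2) hh, repExt_inv K ρ hu k.2, repExt_coe]
    simp only [Matrix.trace, Matrix.diag, Matrix.mul_apply, Matrix.conjTranspose_apply, map_sum, map_mul,
      Complex.star_def, Complex.conj_conj]
  · have hk : (k : G)⁻¹ * h ∉ K := fun hc => hh (by simpa using K.mul_mem k.2 hc)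
    rw [charExt_of_not_mem K ρ hk, repExt_of_not_mem K ρ hh]
    simp

end Coeff

section LeftType

variable (hKo : IsOpen (K : Set G)) (hKc : IsCompact (K : Set G)) (hρ : Continuous ρ)

include hKo hKc hρ in
/-- **`R(eσ) ψ` HAS LEFT TYPE σ** for every continuous `ψ`: `k ↦ R(eσ)ψ(x k)` lies in the span of the matrix
coefficients of `ρ` (substitute `h ↦ k⁻¹ h` in `∫ eσ(h) ψ(x k h) dμ` and expand `conj χ_σ(k⁻¹ h)`). -/
theorem hasLeftType_R_eσ (hu : IsUnitaryRep ρ) {ψ : G → ℂ} (hψ : Continuous ψ) :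
    HasLeftType K (coeff ρ) (S.R (eσ S K ρ) ψ) := by
  haveI := S.haar
  intro x
  set c : ℂ := (d : ℂ) * ((((S.μ (K : Set G)).toReal)⁻¹ : ℝ) : ℂ) with hc
  -- the coefficients
  let b : Fin d → Fin d → ℂ := fun u v => c * ∫ h, starRingEnd ℂ (repExt K ρ h u v) * ψ (x * h) ∂S.μ
  have hint : ∀ u v, Integrable (fun h => starRingEnd ℂ (repExt K ρ h u v) * ψ (x * h)) S.μ := by
    intro u v
    have hcont : Continuous fun h => starRingEnd ℂ (repExt K ρ h u v) * ψ (x * h) :=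
      (continuous_star.comp ((continuous_repExt K ρ hKo hρ).matrix_elem u v)).mul
        (hψ.comp (continuous_const.mul continuous_id))
    have hsupp : HasCompactSupport fun h => starRingEnd ℂ (repExt K ρ h u v) * ψ (x * h) :=
      HasCompactSupport.intro' hKc (K.isClosed_of_isOpen hKo) fun g hg => by
        simp [repExt_of_not_mem K ρ hg]
    exact hcont.integrable_of_hasCompactSupport hsupp
  have key : ∀ k : K, S.R (eσ S K ρ) ψ (x * k) = ∑ u, ∑ v, b u v * ρ k u v := by
    intro k
    unfold R
    -- substitution `h ↦ k⁻¹ h`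
    have hsub := integral_mul_left_eq_self (μ := S.μ) (fun h => eσ S K ρ ((k : G)⁻¹ * h) * ψ (x * h)) (k : G)
    simp only [inv_mul_cancel_left] at hsub
    rw [show (fun h => eσ S K ρ h * ψ (x * k * h)) = fun h => eσ S K ρ h * ψ (x * (k * h)) by
      funext h; rw [mul_assoc], hsub]
    -- expand `eσ (k⁻¹ h)`
    have hexp : ∀ h, eσ S K ρ ((k : G)⁻¹ * h) * ψ (x * h)
        = ∑ u, ∑ v, ρ k u v * (c * (starRingEnd ℂ (repExt K ρ h u v) * ψ (x * h))) := by
      intro h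
      unfold eσ
      rw [← hc, conj_charExt_inv_mul K ρ hu k h, Finset.sum_comm, Finset.mul_sum, Finset.sum_mul]
      refine Finset.sum_congr rfl fun u _ => ?_
      rw [Finset.mul_sum, Finset.sum_mul]
      refine Finset.sum_congr rfl fun v _ => ?_
      ring
    simp_rw [hexp]
    rw [integral_finsetSum _ fun u _ => integrable_finsetSum _ fun v _ => ((hint u v).const_mul c).const_mul (ρ k u v)]
    refine Finset.sum_congr rfl fun u _ => ?_
    rw [integral_finsetSum _ fun v _ => ((hint u v).const_mul c).const_mul (ρ k u v)]
    refine Finset.sum_congr rfl fun v _ => ?_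
    rw [integral_const_mul, integral_const_mul]
    simp only [b]
    ring
  have hfun : (fun k : K => S.R (eσ S K ρ) ψ (x * k))
      = ∑ p : Fin (d * d), b (finProdFinEquiv.symm p).1 (finProdFinEquiv.symm p).2 • coeff ρ p := by
    funext k
    rw [key k, Finset.sum_apply]
    simp only [Pi.smul_apply, smul_eq_mul, coeff]
    rw [← (finProdFinEquiv (m := d) (n := d)).sum_comp]
    simp only [Equiv.symm_apply_apply]
    rw [Fintype.sum_prod_type]
  rw [hfun]
  exact Submodule.sum_mem _ fun p _ => Submodule.smul_mem _ _ (Submodule.subset_span ⟨p, rfl⟩)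

end LeftType

section Block

variable (hKo : IsOpen (K : Set G)) (hKc : IsCompact (K : Set G)) (hρ : Continuous ρ)

/-- **THE TYPE-σ BLOCK**: the fixed space `{ψ | invariant ∧ continuous ∧ R(eσ) ψ = ψ}` of `R(eσ)` on the continuous
invariant functions, as a ℂ-subspace of `G → ℂ` (the `Vb` of p5's `IdempotentData`, with `hVb` definitional; the three
hypotheses make `eσ` a test function so that `R(eσ)` is additive on continuous functions). -/
def isotypicFixed : Submodule ℂ (G → ℂ) where
  carrier := {ψ | S.Invariant ψ ∧ Continuous ψ ∧ S.R (eσ S K ρ) ψ = ψ}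
  add_mem' := by
    intro a b ha hb
    refine ⟨fun γ x => ?_, ha.2.1.add hb.2.1, ?_⟩
    · simp only [Pi.add_apply]
      rw [ha.1 γ x, hb.1 γ x]
    · rw [S.R_add' (isTest_eσ S K ρ hKo hKc hρ) ha.2.1 hb.2.1, ha.2.2, hb.2.2]
  zero_mem' := ⟨fun _ _ => rfl, continuous_const, S.R_zero' _⟩
  smul_mem' := by
    intro c a ha
    refine ⟨fun γ x => ?_, ha.2.1.const_smul c, ?_⟩
    · simp only [Pi.smul_apply]
      rw [ha.1 γ x]
    · rw [S.R_smul', ha.2.2]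

/-- p5's `hVb`, definitionally: membership in the type-σ block. -/
theorem mem_isotypicFixed (ψ : G → ℂ) :
    ψ ∈ isotypicFixed S K ρ hKo hKc hρ ↔ S.Invariant ψ ∧ Continuous ψ ∧ S.R (eσ S K ρ) ψ = ψ := Iff.rfl

/-- the type-σ block lies in p1's level block of left type `coeff ρ` (`hasLeftType_R_eσ` on `R(eσ) ψ = ψ`). -/
theorem isotypicFixed_le_levelBlock (hu : IsUnitaryRep ρ) :
    isotypicFixed S K ρ hKo hKc hρ ≤ levelBlock S K (coeff ρ) := by
  intro ψ hψ
  refine ⟨hψ.1, ?_⟩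
  have := hasLeftType_R_eσ S K ρ hKo hKc hρ hu hψ.2.1
  rwa [hψ.2.2] at this

/-- **THE TYPE-σ BLOCK IS FINITE-DIMENSIONAL** (p1's (A): `finiteDimensional_levelBlock` for the open `K`). -/
theorem finiteDimensional_isotypicFixed (hu : IsUnitaryRep ρ) :
    FiniteDimensional ℂ (isotypicFixed S K ρ hKo hKc hρ) :=
  haveI := finiteDimensional_levelBlock S K (coeff ρ) hKo
  Submodule.finiteDimensional_of_le (isotypicFixed_le_levelBlock S K ρ hKo hKc hρ hu)

end Block

end RTF.Setting

end Summit.Ventures.HodgeRepro.Tier4.Line1
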